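import Summits.Ventures.PercRepro.ProfileCogirth

/-!
# PercRepro — THE INDEPENDENT HALF OF THE PROFILE INEQUALITY UNDER COGIRTH `≥ q + 1` (p10, gen 2; S5 Theorem C)

`proofs/SUBCLAIM-S5-p10.md` §2.5.  For a finite matroid `M` of rank `R` in which every cocircuit has more than `q`
elements, every independent `q`-set `B` has spanning complement (`B` contains no cocircuit), so its profile demand
is `C(R, u−q)`; the contraction `M / B` has rank `R − q` and again cogirth `≥ q + 1` (its cocircuits are those of
`M` avoiding `B`), so by the cogirth lemma it has `≥ C(R, u−q)` independent `(u−q)`-sets; and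
`Σ_{B independent q-set} #{independent (u−q)-sets of M / B} = C(u,q) · #{independent u-sets of M}` (an independent
`u`-set together with one of its `q`-subsets).  Hence

  (INDEP_{q,u})   Σ_{B independent, |B| = q} [u ≤ ρ(E∖B)] · C(ρ(E∖B), u−q)  ≤  C(u,q) · I_u

for every `q ≤ u ≤ R` — the independent half of `(Π_{q,u})` (the other half, over the dependent rank-`q` sets,
is FAT_{q,u}; for `q = 2` it is Theorem B of §2.5, so `(Π_{2,u})` holds on every simple matroid without series
pairs).  For `q ≥ 3` INDEP fails on matroids of smaller cogirth (`U_{2,4} ⊕ U_{2,4}` at `(3,4)`), which is why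
the hypothesis is exactly cogirth `≥ q + 1`.

* `CogirthGe'` — cogirth `≥ g` in the form «a set missing fewer than `g` elements spans»; implies `CogirthGe`;
* `gr_contract_finset`, `rk_contract_add_card`, `rk_gr_contract_add_card` — the contraction by an independent finset;
* `cogirthGe'_contract` — the contraction keeps the cogirth bound;
* `rk_sdiff_eq_of_card_lt` — a set missing `< g` elements spans;
* `card_indepSets_contract_eq`, `sum_card_indepSets_contract` — the double count;
* **`indep_demand_le_choose_mul_card_indepSets`** — (INDEP_{q,u}) under cogirth `≥ q + 1`.
-/

open scoped Matroid

namespace PercRepro.Cogirth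

open Finset ThmH Skew

variable {α : Type} [DecidableEq α] {M : Matroid α} [M.Finite]

/-- **Cogirth at least `g`** in the «spanning» form: every subset of the ground set missing fewer than `g`
elements has full rank.  Equivalent to `CogirthGe M g` (every cocircuit has `≥ g` elements). -/
def CogirthGe' (M : Matroid α) [M.Finite] (g : ℕ) : Prop :=
  ∀ X ⊆ gr M, (gr M \ X).card < g → rk M X = rk M (gr M)

/-- The spanning form implies the rank form used by the cogirth lemma. -/
theorem cogirthGe_of_cogirthGe' {g : ℕ} (h : CogirthGe' M g) : CogirthGe M g := by
  intro X hX hrk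
  by_contra hlt
  have hlt' : (gr M \ X).card < g := Nat.lt_of_not_le hlt
  have := h X hX hlt'
  omega

/-! ### Contraction by an independent finset -/

section Contract

variable {B : Finset α}

/-- The ground finset of `M / B`. -/
theorem gr_contract_finset (B : Finset α) : gr (M ／ (B : Set α)) = gr M \ B := by
  apply Finset.coe_injective
  rw [coe_gr, Matroid.contract_ground, Finset.coe_sdiff, coe_gr]

/-- `ρ_{M/B}(X) + #B = ρ_M(X ∪ B)` for `B` independent and `X` avoiding `B`. -/
theorem rk_contract_add_card (hB : M.Indep (B : Set α)) {X : Finset α} (hX : X ⊆ gr M \ B) :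
    rk (M ／ (B : Set α)) X + B.card = rk M (X ∪ B) := by
  have hXE : (X : Set α) ⊆ M.E \ (B : Set α) := by
    rw [← coe_gr, ← Finset.coe_sdiff]
    exact_mod_cast hX
  have hdisj : Disjoint (X : Set α) (B : Set α) :=
    Set.disjoint_of_subset_left hXE Set.disjoint_sdiff_left
  have hXBE : ((X ∪ B : Finset α) : Set α) ⊆ M.E := by
    rw [Finset.coe_union]
    exact Set.union_subset (hXE.trans Set.sdiff_subset) hB.subset_ground
  obtain ⟨I, hI, hBI⟩ := hB.subset_isBasis_of_subset
    (X := ((X ∪ B : Finset α) : Set α)) (by rw [Finset.coe_union]; exact Set.subset_union_right) hXBE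
  have hI' := hI.contract_isBasis_sdiff_sdiff_of_subset hBI
  have hXB : ((X ∪ B : Finset α) : Set α) \ (B : Set α) = (X : Set α) := by
    rw [Finset.coe_union, Set.union_sdiff_right, hdisj.sdiff_eq_left]
  rw [hXB] at hI'
  have h1 : (M ／ (B : Set α)).eRk (X : Set α) = (I \ (B : Set α)).encard := hI'.eRk_eq_encard
  have h2 : M.eRk ((X ∪ B : Finset α) : Set α) = I.encard := hI.eRk_eq_encard
  have h3 := Set.encard_sdiff_add_encard_of_subset hBI
  rw [← h1, ← h2, Set.encard_coe_eq_coe_finsetCard, ← coe_rk, ← coe_rk] at h3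
  exact_mod_cast h3

/-- The rank of `M / B` is `ρ(E) − #B` for `B` independent. -/
theorem rk_gr_contract_add_card (hB : M.Indep (B : Set α)) (hBg : B ⊆ gr M) :
    rk (M ／ (B : Set α)) (gr (M ／ (B : Set α))) + B.card = rk M (gr M) := by
  rw [gr_contract_finset, rk_contract_add_card hB (subset_refl _), sdiff_union_of_subset hBg]

/-- `gr M \ (X ∪ B) = (gr M \ B) \ X`. -/
theorem sdiff_union_eq_sdiff_sdiff (X B : Finset α) : gr M \ (X ∪ B) = (gr M \ B) \ X := by
  ext x
  simp only [mem_sdiff, mem_union, not_or]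
  tauto

/-- Contracting an independent finset keeps the cogirth bound (spanning form). -/
theorem cogirthGe'_contract {g : ℕ} (hg : CogirthGe' M g) (hB : M.Indep (B : Set α)) (hBg : B ⊆ gr M) :
    CogirthGe' (M ／ (B : Set α)) g := by
  intro X hX hcard
  rw [gr_contract_finset] at hX hcard ⊢
  have h1 := rk_contract_add_card hB hX
  have h2 := rk_gr_contract_add_card hB hBg
  rw [gr_contract_finset] at h2
  have hXB : X ∪ B ⊆ gr M := union_subset (hX.trans sdiff_subset) hBg
  have h3 : rk M (X ∪ B) = rk M (gr M) := by
    apply hg (X ∪ B) hXB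
    rwa [sdiff_union_eq_sdiff_sdiff]
  omega

end Contract

/-- A set missing fewer than `g` elements has full rank: in particular `E ∖ B` for `#B < g`. -/
theorem rk_sdiff_eq_of_card_lt {g : ℕ} (hg : CogirthGe' M g) {B : Finset α} (hBg : B ⊆ gr M)
    (hB : B.card < g) : rk M (gr M \ B) = rk M (gr M) := by
  apply hg (gr M \ B) sdiff_subset
  rwa [Finset.sdiff_sdiff_eq_self hBg]

/-! ### The double count `Σ_B I_{u−q}(M / B) = C(u,q) · I_u` -/

section DoubleCount

variable {q u : ℕ}

/-- For an independent `q`-set `B`, `Y ↦ B ∪ Y` is a bijection from the independent `(u−q)`-sets of `M / B`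
onto the independent `u`-sets of `M` containing `B`. -/
theorem card_indepSets_contract_eq (hqu : q ≤ u) {B : Finset α} (hB : B ∈ indepSets M q) :
    (indepSets (M ／ (B : Set α)) (u - q)).card = ((indepSets M u).filter (fun S => B ⊆ S)).card := by
  rw [mem_indepSets] at hB
  obtain ⟨hBg, hBc, hBi⟩ := hB
  apply card_nbij' (fun Y => B ∪ Y) (fun S => S \ B)
  · intro Y hY
    rw [Finset.mem_coe, mem_indepSets, gr_contract_finset] at hY
    obtain ⟨hYg, hYc, hYi⟩ := hY
    have hdisj : Disjoint Y B := disjoint_of_subset_left hYg sdiff_disjoint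
    rw [Finset.mem_coe, mem_filter, mem_indepSets]
    refine ⟨⟨union_subset hBg (hYg.trans sdiff_subset), ?_, ?_⟩, subset_union_left⟩
    · rw [card_union_of_disjoint hdisj.symm, hBc, hYc]
      omega
    · have h := (hBi.contract_indep_iff.1 hYi).2
      rw [Finset.coe_union, Set.union_comm]
      rw [← Finset.coe_union] at h
      rwa [Finset.coe_union] at h
  · intro S hS
    rw [Finset.mem_coe, mem_filter, mem_indepSets] at hS
    obtain ⟨⟨hSg, hSc, hSi⟩, hBS⟩ := hS
    rw [Finset.mem_coe, mem_indepSets, gr_contract_finset]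
    refine ⟨sdiff_subset_sdiff hSg (subset_refl _), ?_, ?_⟩
    · rw [card_sdiff_of_subset hBS, hSc, hBc]
    · rw [hBi.contract_indep_iff]
      refine ⟨?_, ?_⟩
      · rw [Finset.disjoint_coe]
        exact sdiff_disjoint
      · rw [← Finset.coe_union, sdiff_union_of_subset hBS]
        exact hSi
  · intro Y hY
    rw [Finset.mem_coe, mem_indepSets, gr_contract_finset] at hY
    have hdisj : Disjoint B Y := (disjoint_of_subset_left hY.1 sdiff_disjoint).symm
    simp only
    rw [union_sdiff_cancel_left hdisj]
  · intro S hS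
    rw [Finset.mem_coe, mem_filter] at hS
    simp only
    rw [union_sdiff_of_subset hS.2]

/-- The independent `q`-subsets of an independent `u`-set `S` are its `q`-subsets. -/
theorem filter_indepSets_subset_eq_powersetCard {S : Finset α} (hS : S ∈ indepSets M u) (q : ℕ) :
    (indepSets M q).filter (fun B => B ⊆ S) = S.powersetCard q := by
  rw [mem_indepSets] at hS
  ext B
  rw [mem_filter, mem_indepSets, mem_powersetCard]
  constructor
  · rintro ⟨⟨_, hBc, _⟩, hBS⟩
    exact ⟨hBS, hBc⟩
  · rintro ⟨hBS, hBc⟩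
    refine ⟨⟨hBS.trans hS.1, hBc, hS.2.2.subset (by exact_mod_cast hBS)⟩, hBS⟩

/-- **The double count**: `Σ_{B independent q-set} I_{u−q}(M / B) = C(u,q) · I_u`. -/
theorem sum_card_indepSets_contract (hqu : q ≤ u) :
    ∑ B ∈ indepSets M q, (indepSets (M ／ (B : Set α)) (u - q)).card =
      (indepSets M u).card * u.choose q := by
  calc ∑ B ∈ indepSets M q, (indepSets (M ／ (B : Set α)) (u - q)).card
      = ∑ B ∈ indepSets M q, ((indepSets M u).filter (fun S => B ⊆ S)).card :=
        sum_congr rfl (fun B hB => card_indepSets_contract_eq hqu hB)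
    _ = ∑ B ∈ indepSets M q, ∑ S ∈ indepSets M u, (if B ⊆ S then 1 else 0) := by
        apply sum_congr rfl
        intro B _
        rw [card_filter]
    _ = ∑ S ∈ indepSets M u, ∑ B ∈ indepSets M q, (if B ⊆ S then 1 else 0) := sum_comm
    _ = ∑ S ∈ indepSets M u, ((indepSets M q).filter (fun B => B ⊆ S)).card := by
        apply sum_congr rfl
        intro S _
        rw [card_filter]
    _ = ∑ S ∈ indepSets M u, u.choose q := by
        apply sum_congr rfl
        intro S hS
        rw [filter_indepSets_subset_eq_powersetCard hS, card_powersetCard, (mem_indepSets.1 hS).2.1]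
    _ = (indepSets M u).card * u.choose q := by rw [sum_const, smul_eq_mul]

end DoubleCount

/-! ### The theorem -/

/-- The profile demand of a set `B` at level `u` (in units of `C(u,q)`): `[u ≤ ρ(E∖B)] · C(ρ(E∖B), u−q)`. -/
noncomputable def demand (M : Matroid α) [M.Finite] (q u : ℕ) (B : Finset α) : ℕ :=
  if u ≤ rk M (gr M \ B) then (rk M (gr M \ B)).choose (u - q) else 0

/-- **INDEP_{q,u} under cogirth `≥ q + 1`.**  If every cocircuit of `M` has more than `q` elements, then for
all `q ≤ u ≤ ρ(E)`: `Σ_{B independent, #B = q} demand(B) ≤ C(u,q) · #{independent u-sets}`. -/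
theorem indep_demand_le_choose_mul_card_indepSets {q u : ℕ} (hg : CogirthGe' M (q + 1)) (hqu : q ≤ u)
    (huR : u ≤ rk M (gr M)) :
    ∑ B ∈ indepSets M q, demand M q u B ≤ u.choose q * (indepSets M u).card := by
  have hterm : ∀ B ∈ indepSets M q, demand M q u B ≤ (indepSets (M ／ (B : Set α)) (u - q)).card := by
    intro B hB
    rw [mem_indepSets] at hB
    obtain ⟨hBg, hBc, hBi⟩ := hB
    -- the complement spans
    have hcomp : rk M (gr M \ B) = rk M (gr M) := rk_sdiff_eq_of_card_lt hg hBg (by omega)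
    -- the contraction keeps cogirth `≥ q + 1`, has rank `ρ(E) − q`
    have hg' : CogirthGe (M ／ (B : Set α)) (q + 1) :=
      cogirthGe_of_cogirthGe' (cogirthGe'_contract hg hBi hBg)
    have hrk := rk_gr_contract_add_card hBi hBg
    have hA := choose_le_card_indepSets (M := M ／ (B : Set α)) (g := q + 1) (by omega) hg'
      (j := u - q) (by omega)
    have hmono : (rk M (gr M)).choose (u - q) ≤
        (rk (M ／ (B : Set α)) (gr (M ／ (B : Set α))) + (q + 1) - 1).choose (u - q) :=
      Nat.choose_le_choose _ (by omega)
    unfold demand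
    rw [hcomp, if_pos huR]
    exact hmono.trans hA
  calc ∑ B ∈ indepSets M q, demand M q u B
      ≤ ∑ B ∈ indepSets M q, (indepSets (M ／ (B : Set α)) (u - q)).card := sum_le_sum hterm
    _ = (indepSets M u).card * u.choose q := sum_card_indepSets_contract hqu
    _ = u.choose q * (indepSets M u).card := Nat.mul_comm _ _

end PercRepro.Cogirth
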